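import Summits.Schanuel.Schanuel.Theorems.RootDecomp1KHyper72

/-!
# RootDecomp1KHyper — lens 6, generation 17 «BILOG STAIRCASE CELL» (BilogStair.lean edition 7 637b15ab…, 5821 l; §R TransferI ⟸ ElimDataI) — continuation (RootDecomp1KHyper73): §R (ii) the generic π-clash `pi_clash_fin1` (on the tree-PROVED `pi_measure` via `piMeasure_fin1` + `pb_clash`) and the FAMILY NORM CLASH `resT_family_clash`

(lens-6 g17 `BilogStair.lean` EDITION 7, sha256 637b15ab…d5b9, 5821 l, own farm rc 0 · 0 warn · 0 sorry · axioms std; §A–§P = editions 2–6 (ported as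
`RootDecomp1KHyper53`–`71`), §R appended in edition 7 (NODE/EDITION7 L1820 / REQUEST L1821: statement diff 0 removed / 0 changed / 32 added; critic VERDICT L1827: CLEARED as EDITION 7 of record, `ElimDataI` NOT a costume and TRUE as typed, TransferI credit DEFERRED to its proof; PORT GO (three parts here because of the 398-line cap));
port by census-1 gen 16 in parts `RootDecomp1KHyper72`–`74` — 72 = §R the elimination datum `ElimDataI` (Prop def, UNDECIDED: a Bezout identity between the FIXED
`fI G₁ = G₁(x₁, X, u x₁ + v X)` and `gI P₂` over `B4 = ℤ[x₁, T, u, v]`), `fI_map_eval` / `gI_map_eval`, `evB_of_bezout`, `lenB`, killing the dummy variable (`toFin1`), the integer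
specialisation `specQ` with length/degree bounds, the conjugate transfer for a fixed `R ≠ 0` (`exists_transfer_of_ne_zero`); 73 = the generic π-clash `pi_clash_fin1` and the FAMILY
NORM CLASH `resT_family_clash`; 74 = `norm_aeval_third_le`, `transferI_of_elimData : ElimDataI → TransferI` (PROVED reduction) and `sb_three_zB_of_elimData : ElimDataI → SB 3 zB`.
PORT edits: `sum_fin4` / `one_le_plen` / `cast_div_eq` private (per-part copies); eleven one-line docstrings added; the source's two `set_option linter.unusedSimpArgs false in` lines
(on `fI_map_eval` / `gI_map_eval`) carried as-is; statements and proofs otherwise verbatim. No credit carried (the THEOREM-credit claim «TransferI ⟸ ElimDataI» is the critic's to rule);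
`--supports stmt-Schanuel-33363`; rung 0.)
-/

open Complex Polynomial IntermediateField Filter
open scoped BigOperators

namespace Summit.Schanuel.Schanuel.Theorems.RootDecomp1KHyper

namespace HyperCell

namespace LatCell

namespace Bilog

variable {n : ℕ}
open Summit.Schanuel.Schanuel.Theorems.RootDecomp1KRelLiouvilleCell (mvPolyMeasure_one_of_polyMeasure ycoeff
  mvaeval_cons_eq_sum mvlen_ycoeff_le natDegree_finSuccEquiv_le_totalDegree norm_mvaeval_le_mvlen_mul_pow)

open Summit.Schanuel.Schanuel.Theorems.RootDecomp1KGeneric (norm_mvAeval_sub_le norm_cexp_sub_cexp_le lenMv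
  lenMv_nonneg)

section CaseI

/-! ### The generic `π`-clash: a family of integer polynomials in `π` alone with polynomially bounded degree and
log-length cannot take hyper-small nonzero values (the tree-PROVED measure of `π`, `piMeasure_fin1`) -/

/-- THE `π`-CLASH.  If `N₁(k) ∈ ℤ[x₁]` has degree `≤ H_k^{O(1)}`, length `≤ exp(H_k^{O(1)})` and (whenever `good k`
and `N₁(k) ≠ 0`) `‖N₁(k)(π)‖ ≤ exp(E_k)·ε_k` with `E` polynomially bounded and `ε` hyper-small, then eventually
`good k → N₁(k) = 0`. -/
theorem pi_clash_fin1 {a b : ℕ → ℚ} (good : ℕ → Prop) (N1 : ℕ → MvPolynomial (Fin 1) ℤ)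
    (hdeg : PB a b fun k => ((N1 k).totalDegree : ℝ))
    (hlen : ∃ c : ℕ, ∀ᶠ k in atTop, ((mvlen (N1 k) : ℤ) : ℝ) ≤ Real.exp (hgt a b k ^ c))
    {ε E : ℕ → ℝ} (hε0 : ∀ᶠ k in atTop, 0 ≤ ε k)
    (hεsmall : ∀ m : ℕ, ∀ᶠ k in atTop, ε k < Real.exp (-(hgt a b k) ^ m)) (hE : PB a b E)
    (hval : ∀ᶠ k in atTop, good k → N1 k ≠ 0 →
      ‖MvPolynomial.aeval ![(Real.pi : ℂ)] (N1 k)‖ ≤ Real.exp (E k) * ε k) :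
    ∀ᶠ k in atTop, good k → N1 k = 0 := by
  classical
  obtain ⟨c, hc⟩ := hlen
  obtain ⟨d, hd⟩ : ∃ d : ℕ → ℕ, d = fun k => (N1 k).totalDegree + 1 := ⟨_, rfl⟩
  obtain ⟨M, hM⟩ : ∃ M : ℕ → ℝ, M = fun k => ((mvlen (N1 k) : ℤ) : ℝ) := ⟨_, rfl⟩
  obtain ⟨Λ, hΛ⟩ : ∃ Λ : ℕ → ℝ, Λ = fun k => ((d k : ℝ) + 1) * M k + 3 := ⟨_, rfl⟩
  obtain ⟨ψ, hψ⟩ : ∃ ψ : ℕ → ℝ, ψ = fun k =>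
      2 * 10 ^ 6 * (d k : ℝ) * (Real.log (Λ k) + d k * Real.log (d k)) * (1 + Real.log (d k)) := ⟨_, rfl⟩
  have hH3 : ∀ k, 3 ≤ hgt a b k := three_le_hgt a b
  have hd1 : ∀ k, 1 ≤ d k := fun k => by rw [hd]; exact Nat.le_add_left 1 _
  have hd1R : ∀ k, (1 : ℝ) ≤ d k := fun k => by exact_mod_cast hd1 k
  have hM0 : ∀ k, 0 ≤ M k := fun k => by rw [hM]; dsimp only; exact_mod_cast mvlen_nonneg _
  have hΛ3 : ∀ k, 3 ≤ Λ k := fun k => by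
    rw [hΛ]; dsimp only
    have := hM0 k
    have : (0 : ℝ) ≤ d k := by positivity
    nlinarith
  have pbd : PB a b fun k => (d k : ℝ) :=
    pb_of_le (pb_add hdeg (pb_const 1)) (Filter.Eventually.of_forall fun k => by rw [hd]; push_cast; exact le_rfl)
  have hlogM : ∀ᶠ k in atTop, Real.log (M k + 1) ≤ 1 + hgt a b k ^ c := hc.mono fun k hk => by
    rw [hM] at *
    dsimp only at hk ⊢
    have h0 : (0 : ℝ) ≤ ((mvlen (N1 k) : ℤ) : ℝ) := by exact_mod_cast mvlen_nonneg _
    have h1 : 1 ≤ Real.exp (hgt a b k ^ c) := Real.one_le_exp (pow_nonneg (by linarith [hH3 k]) _)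
    calc Real.log (((mvlen (N1 k) : ℤ) : ℝ) + 1) ≤ Real.log (2 * Real.exp (hgt a b k ^ c)) :=
          Real.log_le_log (by linarith) (by linarith)
      _ = Real.log 2 + hgt a b k ^ c := by
          rw [Real.log_mul (by norm_num) (Real.exp_pos _).ne', Real.log_exp]
      _ ≤ 1 + hgt a b k ^ c := by
          have h2 : Real.log 2 ≤ 1 := by linarith [Real.log_le_sub_one_of_pos (by norm_num : (0 : ℝ) < 2)]
          linarith
  have hlogΛ : ∀ᶠ k in atTop, Real.log (Λ k) ≤ ((d k : ℝ) + 4) + (1 + hgt a b k ^ c) :=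
    hlogM.mono fun k hk => by
      have hd0 : (0 : ℝ) ≤ d k := by positivity
      have hΛle : Λ k ≤ ((d k : ℝ) + 4) * (M k + 1) := by rw [hΛ]; dsimp only; nlinarith [hM0 k]
      calc Real.log (Λ k) ≤ Real.log (((d k : ℝ) + 4) * (M k + 1)) :=
            Real.log_le_log (by linarith [hΛ3 k]) hΛle
        _ = Real.log ((d k : ℝ) + 4) + Real.log (M k + 1) :=
            Real.log_mul (by positivity) (by linarith [hM0 k])
        _ ≤ _ := add_le_add (Real.log_le_self (by positivity)) hk
  have pb_logΛ : PB a b fun k => Real.log (Λ k) :=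
    pb_of_le (pb_add (pb_add pbd (pb_const 4)) (pb_add (pb_const 1) (pb_pow_hgt c))) hlogΛ
  have hlogΛ0 : ∀ k, 0 ≤ Real.log (Λ k) := fun k => Real.log_nonneg (by linarith [hΛ3 k])
  have hψle : ∀ k, ψ k ≤ 2 * 10 ^ 6 * (d k : ℝ) * (Real.log (Λ k) + d k * d k) * (1 + d k) := fun k => by
    rw [hψ]; dsimp only
    have hd0 : (0 : ℝ) ≤ d k := by positivity
    have hld : Real.log (d k) ≤ d k := Real.log_le_self hd0
    have hld0 : 0 ≤ Real.log (d k) := Real.log_nonneg (hd1R k)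
    have h1 : Real.log (Λ k) + d k * Real.log (d k) ≤ Real.log (Λ k) + d k * d k := by nlinarith
    have h2 : 1 + Real.log (d k) ≤ 1 + d k := by linarith
    have h0 : 0 ≤ Real.log (Λ k) + d k * Real.log (d k) := by nlinarith [hlogΛ0 k]
    calc 2 * 10 ^ 6 * (d k : ℝ) * (Real.log (Λ k) + d k * Real.log (d k)) * (1 + Real.log (d k))
        = 2 * 10 ^ 6 * (d k : ℝ) * ((Real.log (Λ k) + d k * Real.log (d k)) * (1 + Real.log (d k))) := by ring
      _ ≤ 2 * 10 ^ 6 * (d k : ℝ) * ((Real.log (Λ k) + d k * d k) * (1 + d k)) :=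
          mul_le_mul_of_nonneg_left (mul_le_mul h1 h2 (by positivity) (by nlinarith [hlogΛ0 k])) (by positivity)
      _ = _ := by ring
  have pbψ : PB a b ψ := by
    refine pb_of_le (pb_mul (pb_mul (pb_mul (pb_const _) pbd (Filter.Eventually.of_forall fun k => by positivity)
      (Filter.Eventually.of_forall fun k => by positivity)) (pb_add pb_logΛ (pb_mul pbd pbd
      (Filter.Eventually.of_forall fun k => by positivity) (Filter.Eventually.of_forall fun k => by positivity)))
      (Filter.Eventually.of_forall fun k => by positivity)
      (Filter.Eventually.of_forall fun k => by nlinarith [hlogΛ0 k, hd1R k]))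
      (pb_add (pb_const 1) pbd) (Filter.Eventually.of_forall fun k => ?_)
      (Filter.Eventually.of_forall fun k => by positivity)) (Filter.Eventually.of_forall hψle)
    have : (0 : ℝ) ≤ d k := by positivity
    have := hlogΛ0 k
    positivity
  have hclash := pb_clash (pb_add pbψ hE) hεsmall hε0
  filter_upwards [hclash, hval] with k hcl hvk
  intro hgood
  by_contra hN
  have hup := hvk hgood hN
  have hdeg' : (N1 k).totalDegree ≤ d k := by rw [hd]; exact Nat.le_succ _
  have hΛk : ((d k : ℝ) + 1) * ((mvlen (N1 k) : ℤ) : ℝ) + 3 ≤ Λ k := by rw [hΛ, hM]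
  have hlow : Real.exp (-ψ k) ≤ ‖MvPolynomial.aeval ![(Real.pi : ℂ)] (N1 k)‖ := by
    rw [hψ]; exact piMeasure_fin1 (N1 k) hN (hd1 k) hdeg' hΛk
  have h1 : (1 : ℝ) ≤ Real.exp (ψ k + E k) * ε k := by
    calc (1 : ℝ) = Real.exp (ψ k) * Real.exp (-ψ k) := by rw [← Real.exp_add, add_neg_cancel, Real.exp_zero]
      _ ≤ Real.exp (ψ k) * (Real.exp (E k) * ε k) :=
          mul_le_mul_of_nonneg_left (hlow.trans hup) (by positivity)
      _ = Real.exp (ψ k + E k) * ε k := by rw [Real.exp_add]; ring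
  linarith

/-- `plen f ≥ 1` for `f ≠ 0`. -/
private theorem one_le_plen {f : ℤ[X]} (hf : f ≠ 0) : 1 ≤ plen f := by
  have h1 : (1 : ℤ) ≤ |f.coeff f.natDegree| := Int.one_le_abs (Polynomial.leadingCoeff_ne_zero.mpr hf)
  refine h1.trans ?_
  unfold plen
  exact Finset.single_le_sum (f := fun i => |f.coeff i|) (fun _ _ => abs_nonneg _)
    (Polynomial.natDegree_mem_support_of_nonzero hf)

/-- THE FAMILY NORM CLASH.  Conjugate data `f_k` (as delivered by `ConjDataII`) with a root `γ_k` of `f_k`, a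
family `Q_k ∈ ℤ[x₁, x₂, T]` of bounded degree and length `≤ exp(H^{O(1)})` whose value at `(π, 0, γ_k)` is
`≤ exp(E_k)·ε_k` (`E` polynomially bounded, `ε` hyper-small): then eventually `Q_k(π, 0, ·)` vanishes at a root
of `f_k` — by the `π`-clash applied to `N_k := Res_T(f_k, Q_k)(x₁, 0) ∈ ℤ[x₁]`. -/
theorem resT_family_clash {a b : ℕ → ℚ} {f : ℕ → ℤ[X]} {c : ℕ} (hf0 : ∀ k, f k ≠ 0)
    {γ : ℕ → ℂ} (hfγ : ∀ k, Polynomial.aeval (γ k) (f k) = 0)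
    (hfdeg : ∀ᶠ k in atTop, ((f k).natDegree : ℝ) ≤ hgt a b k ^ c)
    (hfcoef : ∀ᶠ k in atTop, ∀ i, (|(f k).coeff i| : ℝ) ≤ Real.exp (hgt a b k ^ c))
    (hfroot : ∀ᶠ k in atTop, ∀ z : ℂ, Polynomial.aeval z (f k) = 0 → ‖z‖ ≤ Real.exp (hgt a b k ^ c))
    (Q : ℕ → MvPolynomial (Fin 3) ℤ) {D cQ : ℕ} (hQdeg : ∀ k, (Q k).totalDegree ≤ D)
    (hQlen : ∀ᶠ k in atTop, ((mvlen (Q k) : ℤ) : ℝ) ≤ Real.exp (hgt a b k ^ cQ))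
    {ε E : ℕ → ℝ} (hε0 : ∀ᶠ k in atTop, 0 ≤ ε k)
    (hεsmall : ∀ m : ℕ, ∀ᶠ k in atTop, ε k < Real.exp (-(hgt a b k) ^ m)) (hE : PB a b E)
    (hQval : ∀ᶠ k in atTop,
      ‖MvPolynomial.aeval ![(Real.pi : ℂ), 0, γ k] (Q k)‖ ≤ Real.exp (E k) * ε k) :
    ∀ᶠ k in atTop, ∃ z : ℂ, Polynomial.aeval z (f k) = 0 ∧
      MvPolynomial.aeval ![(Real.pi : ℂ), 0, z] (Q k) = 0 := by
  classical
  have hH3 : ∀ k, (3 : ℝ) ≤ hgt a b k := three_le_hgt a b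
  have hH1 : ∀ k, (1 : ℝ) ≤ hgt a b k := fun k => by linarith [hH3 k]
  have hD0 : (0 : ℝ) ≤ (D : ℝ) := Nat.cast_nonneg D
  obtain ⟨dk, hdk⟩ : ∃ dk : ℕ → ℝ, dk = fun k => ((f k).natDegree : ℝ) := ⟨_, rfl⟩
  have hdkk : ∀ k, dk k = ((f k).natDegree : ℝ) := fun k => by rw [hdk]
  have hdkPB : PB a b dk := pb_of_le (pb_pow_hgt c) (hfdeg.mono fun k hk => by rw [hdkk]; exact hk)
  have hdk0 : ∀ k, 0 ≤ dk k := fun k => by rw [hdkk]; exact Nat.cast_nonneg _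
  have hnD : ∀ k, (toPolyT (Q k)).natDegree ≤ D := fun k => (natDegree_toPolyT_le _).trans (hQdeg k)
  obtain ⟨N1, hN1⟩ : ∃ N1 : ℕ → MvPolynomial (Fin 1) ℤ, N1 = fun k => toFin1 (resT (f k) (Q k)) := ⟨_, rfl⟩
  -- degree
  have hdegPB : PB a b fun k => ((N1 k).totalDegree : ℝ) := by
    refine pb_of_le (pb_mul (pb_add hdkPB (pb_const (D : ℝ))) (pb_const (D : ℝ))
      (Filter.Eventually.of_forall fun k => by linarith [hdk0 k])
      (Filter.Eventually.of_forall fun _ => hD0)) (Filter.Eventually.of_forall fun k => ?_)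
    have h := (resT_bounds (f k) (Q k)).2
    have h1 := totalDegree_toFin1_le (resT (f k) (Q k))
    have h2 : ((f k).natDegree + (toPolyT (Q k)).natDegree) * (Q k).totalDegree ≤ ((f k).natDegree + D) * D :=
      Nat.mul_le_mul (Nat.add_le_add_left (hnD k) _) (hQdeg k)
    rw [hN1, hdkk]; dsimp only
    exact_mod_cast h1.trans (h.trans h2)
  -- length
  have hBk : ∀ᶠ k in atTop, ((plen (f k) : ℤ) : ℝ) ≤ (dk k + 1) * Real.exp (hgt a b k ^ c) := by
    filter_upwards [hfcoef] with k hk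
    rw [hdkk]
    unfold plen
    push_cast
    calc ∑ i ∈ (f k).support, |((f k).coeff i : ℝ)| ≤ ∑ i ∈ (f k).support, Real.exp (hgt a b k ^ c) :=
          Finset.sum_le_sum fun i _ => hk i
      _ = ((f k).support.card : ℝ) * Real.exp (hgt a b k ^ c) := by rw [Finset.sum_const, nsmul_eq_mul]
      _ ≤ (((f k).natDegree : ℝ) + 1) * Real.exp (hgt a b k ^ c) := by
          apply mul_le_mul_of_nonneg_right _ (Real.exp_pos _).le
          exact_mod_cast Polynomial.card_supp_le_succ_natDegree (f k)
  obtain ⟨F, hF⟩ : ∃ F : ℕ → ℝ,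
      F = fun k => (dk k + D) * (dk k + D) + (dk k + D) * ((dk k + 2) + hgt a b k ^ c + hgt a b k ^ cQ) :=
    ⟨_, rfl⟩
  have hFPB : PB a b F := by
    rw [hF]
    have h1 : PB a b fun k => dk k + D := pb_add hdkPB (pb_const _)
    have h1' : ∀ᶠ k in atTop, 0 ≤ dk k + D := Filter.Eventually.of_forall fun k => by linarith [hdk0 k]
    refine pb_add (pb_mul h1 h1 h1' h1') (pb_mul h1 (pb_add (pb_add (pb_add hdkPB (pb_const 2))
      (pb_pow_hgt c)) (pb_pow_hgt cQ)) h1' ?_)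
    exact Filter.Eventually.of_forall fun k => by
      linarith [hdk0 k, pow_nonneg (by linarith [hH3 k] : (0 : ℝ) ≤ hgt a b k) c,
        pow_nonneg (by linarith [hH3 k] : (0 : ℝ) ≤ hgt a b k) cQ]
  have hlen : ∀ᶠ k in atTop, ((mvlen (N1 k) : ℤ) : ℝ) ≤ Real.exp (F k) := by
    filter_upwards [hBk, hQlen] with k hk hkQ
    have h := (resT_bounds (f k) (Q k)).1
    have h0 : ((mvlen (N1 k) : ℤ) : ℝ) ≤ ((mvlen (resT (f k) (Q k)) : ℤ) : ℝ) := by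
      rw [hN1]; exact_mod_cast mvlen_toFin1_le _
    refine h0.trans ?_
    have hpl1 : (1 : ℝ) ≤ ((plen (f k) : ℤ) : ℝ) := by exact_mod_cast one_le_plen (hf0 k)
    have hmQ0 : (0 : ℝ) ≤ ((mvlen (Q k) : ℤ) : ℝ) := by exact_mod_cast mvlen_nonneg _
    obtain ⟨Bq, hBq⟩ : ∃ Bq : ℝ, Bq = ((plen (f k) : ℤ) : ℝ) + ((mvlen (Q k) : ℤ) : ℝ) := ⟨_, rfl⟩
    have hB1 : 1 ≤ Bq := by rw [hBq]; linarith
    have hBpos : 0 < Bq := by linarith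
    obtain ⟨m, hm⟩ : ∃ m : ℕ, m = (f k).natDegree + (toPolyT (Q k)).natDegree := ⟨_, rfl⟩
    have hmle : (m : ℝ) ≤ dk k + D := by
      rw [hm, hdkk]; push_cast
      have : ((toPolyT (Q k)).natDegree : ℝ) ≤ D := by exact_mod_cast hnD k
      linarith
    have hm0 : (0 : ℝ) ≤ m := Nat.cast_nonneg m
    rw [← hm] at h
    have he1 : (1 : ℝ) ≤ Real.exp (hgt a b k ^ c) := Real.one_le_exp (pow_nonneg (by linarith [hH3 k]) c)
    have he2 : (1 : ℝ) ≤ Real.exp (hgt a b k ^ cQ) := Real.one_le_exp (pow_nonneg (by linarith [hH3 k]) cQ)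
    have hlogB : Real.log Bq ≤ (dk k + 2) + hgt a b k ^ c + hgt a b k ^ cQ := by
      have hle : Bq ≤ (dk k + 2) * (Real.exp (hgt a b k ^ c) * Real.exp (hgt a b k ^ cQ)) := by
        rw [hBq]
        have h3 : ((mvlen (Q k) : ℤ) : ℝ) ≤ Real.exp (hgt a b k ^ c) * Real.exp (hgt a b k ^ cQ) := by
          nlinarith [hkQ, he1, (Real.exp_pos (hgt a b k ^ cQ)).le]
        have h4 : ((plen (f k) : ℤ) : ℝ) ≤ (dk k + 1) * (Real.exp (hgt a b k ^ c) * Real.exp (hgt a b k ^ cQ)) :=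
          by nlinarith [hk, he2, (Real.exp_pos (hgt a b k ^ c)).le, hdk0 k]
        nlinarith [h3, h4]
      have hpos2 : (0 : ℝ) < dk k + 2 := by linarith [hdk0 k]
      calc Real.log Bq ≤ Real.log ((dk k + 2) * (Real.exp (hgt a b k ^ c) * Real.exp (hgt a b k ^ cQ))) :=
            Real.log_le_log hBpos hle
        _ = Real.log (dk k + 2) + (hgt a b k ^ c + hgt a b k ^ cQ) := by
            rw [Real.log_mul hpos2.ne' (by positivity), ← Real.exp_add, Real.log_exp]
        _ ≤ (dk k + 2) + hgt a b k ^ c + hgt a b k ^ cQ := by linarith [Real.log_le_self hpos2.le]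
    have hlogB0 : 0 ≤ Real.log Bq := Real.log_nonneg hB1
    calc ((mvlen (resT (f k) (Q k)) : ℤ) : ℝ) ≤ ((Nat.factorial m : ℤ) : ℝ) * Bq ^ m := by
          rw [hBq]; exact_mod_cast h
      _ ≤ Real.exp ((dk k + D) * (dk k + D)) *
          Real.exp ((dk k + D) * ((dk k + 2) + hgt a b k ^ c + hgt a b k ^ cQ)) := by
          apply mul_le_mul _ _ (pow_nonneg hBpos.le _) (Real.exp_pos _).le
          · calc ((Nat.factorial m : ℤ) : ℝ) = (Nat.factorial m : ℝ) := by norm_cast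
              _ ≤ ((m ^ m : ℕ) : ℝ) := by exact_mod_cast Nat.factorial_le_pow m
              _ = (m : ℝ) ^ m := by push_cast; ring
              _ ≤ Real.exp (m : ℝ) ^ m :=
                  pow_le_pow_left₀ (Nat.cast_nonneg _) (by linarith [Real.add_one_le_exp (m : ℝ)]) m
              _ = Real.exp ((m : ℝ) * m) := by rw [← Real.exp_nat_mul]
              _ ≤ Real.exp ((dk k + D) * (dk k + D)) :=
                  Real.exp_le_exp.mpr (mul_le_mul hmle hmle hm0 (by linarith [hdk0 k]))
          · calc Bq ^ m = Real.exp (Real.log Bq) ^ m := by rw [Real.exp_log hBpos]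
              _ = Real.exp ((m : ℝ) * Real.log Bq) := by rw [← Real.exp_nat_mul]
              _ ≤ Real.exp ((dk k + D) * ((dk k + 2) + hgt a b k ^ c + hgt a b k ^ cQ)) :=
                  Real.exp_le_exp.mpr (mul_le_mul hmle hlogB hlogB0 (by linarith [hdk0 k]))
      _ = Real.exp (F k) := by rw [← Real.exp_add, hF]
  obtain ⟨c₃, hc₃⟩ := hFPB
  have hlenH : ∃ c' : ℕ, ∀ᶠ k in atTop, ((mvlen (N1 k) : ℤ) : ℝ) ≤ Real.exp (hgt a b k ^ c') :=
    ⟨c₃, (hlen.and hc₃).mono fun k hk => hk.1.trans (Real.exp_le_exp.mpr hk.2)⟩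
  -- value
  obtain ⟨Lb, hLb⟩ : ∃ Lb : ℕ → ℝ, Lb = fun k => hgt a b k ^ cQ + D * (hgt a b k ^ c + 2) := ⟨_, rfl⟩
  obtain ⟨E', hE'⟩ : ∃ E' : ℕ → ℝ, E' = fun k => D * hgt a b k ^ c + dk k * Lb k + E k := ⟨_, rfl⟩
  have hLb0 : ∀ k, 0 ≤ Lb k := fun k => by
    rw [hLb]
    exact add_nonneg (pow_nonneg (by linarith [hH3 k]) cQ)
      (mul_nonneg hD0 (add_nonneg (pow_nonneg (by linarith [hH3 k]) c) (by norm_num)))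
  have hLbPB : PB a b Lb := by
    rw [hLb]
    exact pb_add (pb_pow_hgt cQ) (pb_mul (pb_const _) (pb_add (pb_pow_hgt c) (pb_const 2))
      (Filter.Eventually.of_forall fun _ => hD0)
      (Filter.Eventually.of_forall fun k => add_nonneg (pow_nonneg (by linarith [hH3 k]) c) (by norm_num)))
  have hE'PB : PB a b E' := by
    rw [hE']
    exact pb_add (pb_add (pb_mul (pb_const _) (pb_pow_hgt c) (Filter.Eventually.of_forall fun _ => hD0)
      (Filter.Eventually.of_forall fun k => pow_nonneg (by linarith [hH3 k]) c))
      (pb_mul hdkPB hLbPB (Filter.Eventually.of_forall hdk0) (Filter.Eventually.of_forall hLb0))) hE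
  have hval : ∀ᶠ k in atTop, Q k ≠ 0 → N1 k ≠ 0 →
      ‖MvPolynomial.aeval ![(Real.pi : ℂ)] (N1 k)‖ ≤ Real.exp (E' k) * ε k := by
    filter_upwards [hfcoef, hfroot, hQlen, hQval, hε0] with k hkc hkr hkQ hkv hεk
    intro hQ0 _
    rw [hN1]; dsimp only
    rw [aeval_toFin1]
    have hHk := hH3 k
    have hHc0 : (0 : ℝ) ≤ hgt a b k ^ c := pow_nonneg (by linarith) c
    obtain ⟨R, hR⟩ : ∃ R : ℝ, R = Real.exp (hgt a b k ^ c) * 4 := ⟨_, rfl⟩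
    have he1 : (1 : ℝ) ≤ Real.exp (hgt a b k ^ c) := Real.one_le_exp hHc0
    have hR4 : 4 ≤ R := by rw [hR]; nlinarith
    have hR1 : 1 ≤ R := by linarith
    have hRe : Real.exp (hgt a b k ^ c) ≤ R := by rw [hR]; nlinarith
    have hx : ‖(Real.pi : ℂ)‖ ≤ R := by
      rw [Complex.norm_real, Real.norm_eq_abs, abs_of_pos Real.pi_pos]
      linarith [Real.pi_lt_four]
    have hy : ‖(0 : ℂ)‖ ≤ R := by rw [norm_zero]; linarith
    have hroots' : ∀ z : ℂ, Polynomial.aeval z (f k) = 0 → ‖z‖ ≤ R := fun z hz => (hkr z hz).trans hRe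
    have h := norm_resT_le (hf0 k) hQ0 (hfγ k) hR1 hx hy hroots'
    refine h.trans ?_
    obtain ⟨n, hn⟩ : ∃ n : ℕ, n = (toPolyT (Q k)).natDegree := ⟨_, rfl⟩
    obtain ⟨LQ, hLQ⟩ : ∃ LQ : ℝ, LQ = ((mvlen (Q k) : ℤ) : ℝ) := ⟨_, rfl⟩
    rw [← hn, ← hLQ]
    have hLQ1 : 1 ≤ LQ := by
      rw [hLQ]
      obtain ⟨mm, hmm⟩ := MvPolynomial.ne_zero_iff.mp hQ0
      exact_mod_cast (Int.one_le_abs hmm).trans (abs_coeff_le_mvlen _ mm)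
    have hLQ0 : 0 ≤ LQ := by linarith
    have hlc : |((f k).leadingCoeff : ℝ)| ≤ Real.exp (hgt a b k ^ c) := by
      rw [Polynomial.leadingCoeff]; exact hkc _
    have h1 : |((f k).leadingCoeff : ℝ)| ^ n ≤ Real.exp ((D : ℝ) * hgt a b k ^ c) := by
      calc |((f k).leadingCoeff : ℝ)| ^ n ≤ Real.exp (hgt a b k ^ c) ^ n := pow_le_pow_left₀ (abs_nonneg _) hlc n
        _ ≤ Real.exp (hgt a b k ^ c) ^ D := pow_le_pow_right₀ he1 (by rw [hn]; exact hnD k)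
        _ = Real.exp ((D : ℝ) * hgt a b k ^ c) := by rw [← Real.exp_nat_mul]
    have hM1 : (1 : ℝ) ≤ LQ * R ^ (Q k).totalDegree := by
      nlinarith [one_le_pow₀ (M₀ := ℝ) hR1 (n := (Q k).totalDegree)]
    have hMpos : (0 : ℝ) < LQ * R ^ (Q k).totalDegree := by linarith
    have hlogR : Real.log R ≤ hgt a b k ^ c + 2 := by
      rw [hR, Real.log_mul (Real.exp_pos _).ne' (by norm_num), Real.log_exp]
      have h4 : Real.log 4 ≤ 2 := by
        have := Real.log_le_sub_one_of_pos (by norm_num : (0 : ℝ) < 4)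
        have h2 : Real.log 4 = 2 * Real.log 2 := by
          rw [show (4 : ℝ) = 2 ^ 2 by norm_num, Real.log_pow]; norm_num
        rw [h2]; linarith [Real.log_le_sub_one_of_pos (by norm_num : (0 : ℝ) < 2)]
      linarith
    have hlogR0 : 0 ≤ Real.log R := Real.log_nonneg hR1
    have hlogM : Real.log (LQ * R ^ (Q k).totalDegree) ≤ Lb k := by
      rw [hLb]; dsimp only
      rw [Real.log_mul (by linarith) (pow_pos (by linarith) _).ne', Real.log_pow]
      have hl1 : Real.log LQ ≤ hgt a b k ^ cQ := by
        calc Real.log LQ ≤ Real.log (Real.exp (hgt a b k ^ cQ)) :=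
              Real.log_le_log (by linarith) (by rw [hLQ]; exact hkQ)
          _ = hgt a b k ^ cQ := Real.log_exp _
      have hl2 : ((Q k).totalDegree : ℝ) * Real.log R ≤ D * (hgt a b k ^ c + 2) :=
        mul_le_mul (by exact_mod_cast hQdeg k) hlogR hlogR0 hD0
      linarith
    have h2 : (LQ * R ^ (Q k).totalDegree) ^ ((f k).natDegree - 1) ≤ Real.exp (dk k * Lb k) := by
      calc (LQ * R ^ (Q k).totalDegree) ^ ((f k).natDegree - 1) ≤ (LQ * R ^ (Q k).totalDegree) ^ (f k).natDegree :=
            pow_le_pow_right₀ hM1 (Nat.sub_le _ _)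
        _ = Real.exp (Real.log (LQ * R ^ (Q k).totalDegree)) ^ (f k).natDegree := by rw [Real.exp_log hMpos]
        _ = Real.exp (((f k).natDegree : ℝ) * Real.log (LQ * R ^ (Q k).totalDegree)) := by
            rw [← Real.exp_nat_mul]
        _ ≤ Real.exp (dk k * Lb k) := by
            rw [hdkk]
            exact Real.exp_le_exp.mpr (mul_le_mul_of_nonneg_left hlogM (Nat.cast_nonneg _))
    calc |((f k).leadingCoeff : ℝ)| ^ n * ((LQ * R ^ (Q k).totalDegree) ^ ((f k).natDegree - 1) *
          ‖MvPolynomial.aeval ![(Real.pi : ℂ), 0, γ k] (Q k)‖)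
        ≤ Real.exp ((D : ℝ) * hgt a b k ^ c) * (Real.exp (dk k * Lb k) * (Real.exp (E k) * ε k)) :=
          mul_le_mul h1 (mul_le_mul h2 hkv (norm_nonneg _) (Real.exp_pos _).le)
            (mul_nonneg (pow_nonneg hMpos.le _) (norm_nonneg _)) (Real.exp_pos _).le
      _ = Real.exp (E' k) * ε k := by
          rw [hE']; dsimp only; rw [Real.exp_add, Real.exp_add]; ring
  have hclash := pi_clash_fin1 (fun k => Q k ≠ 0) N1 hdegPB hlenH hε0 hεsmall hE'PB hval
  filter_upwards [hclash] with k hk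
  by_cases hQ0 : Q k = 0
  · exact ⟨γ k, hfγ k, by rw [hQ0, map_zero]⟩
  · have hN1k := hk hQ0
    rw [hN1] at hN1k; dsimp only at hN1k
    have h0 : MvPolynomial.aeval ![(Real.pi : ℂ), 0] (resT (f k) (Q k)) = 0 := by
      rw [← aeval_toFin1, hN1k, map_zero]
    obtain ⟨z, hz, hQz⟩ := resT_zero (hf0 k) (Q k) h0
    exact ⟨z, hz, hQz⟩

end CaseI

end Bilog
end LatCell
end HyperCell
end Summit.Schanuel.Schanuel.Theorems.RootDecomp1KHyper
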